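import Summits.CriticalPhenomena.PercolationContinuityZ3.Theorems.PercShatteringRaceNearLinearTwoClusterDecayStubPairAspectOfTwoArm
import Summits.CriticalPhenomena.PercolationContinuityZ3.Theorems.PercShatteringRaceNearLinearTwoClusterDecayCritFrontierAllP
import HarnessLib

/-!
# Crux `PercShatteringRace.NearLinearTwoClusterDecay` (stmt-CriticalPhenomena-5785) — the PAIR-form unconditional frontier

Certificate file of the line `pair-decay-long-arms-dense` (§ Pair-form frontier, skeleton rev L12-c8); lands with
`--supports stmt-CriticalPhenomena-5785`.

The crux `U(1/6)` (union form: SOME two sites of `Λ_n` joined inside `Λ_N`, `N = ⌈n^{7/6}⌉`, to `∂ⁱⁿΛ_N` but not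
to each other) follows from its PAIR form `PairTwoArmsDecay` (for ALL deterministic `x, x' ∈ Λ_n`, eventually and
uniformly; the prepared child 1 of the split, `Theorems.nearLinearTwoClusterDecay_of_subs`) together with the residue
`LongArmsAreDense`.  The union-form family decays at every aspect exponent `A > 44` unconditionally
(`NearLinearTwoClusterDecay.CritFrontier.twoClusterDecay_of_gt_44`, bond Cerf 2015 Thm 1.2 on `ℤ³`).  For the PAIR
form Cerf's Lemma 7.1 needs no union bound over the pairs (`Theorems.stub_pairAspectOfTwoArm`, F1: `κA > 6 + e`
instead of `10 + e`), so the same inputs — the pair-connection bound `P_p(a ↔ b in Λ_{2n}) ≥ c n^{-12}` at every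
`p ≥ p_c` (W4 `stub_superCritPairConnLower`), the AKN two-arms exponent (every `κ < 1/2` at every `p ∈ (0,1)`,
`CritFrontier.twoArm_of_lt_half_at`) and, at `p_c`, bond Cerf Thm 1.1 (W2 `stub_critTwoArmImproved`, some
`κ > 1/2`) — give:

* `pairDecay_of_gt_36` — for EVERY `p < 1` and every `A > 36`, pair-form decay at exponent `A` under `P_p`
  (below `p_c` by sharpness at every `A > 1`, `pairDecay_subcritical`);
* `critPairDecay_of_ge_36` — at `p_c`, pair-form decay at every `A ≥ 36` (endpoint by W2; no monotonicity needed);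
* `pairDecay_of_twoClusterDecay` — the union form dominates the pair form at every parameter and exponent.

Child 1 `PairTwoArmsDecay` is the instance `p = p_c`, `A = 7/6` of the pair family (skeleton:
`childOne_iff_pairAtExponent`, `Iff.rfl`).  HONEST SCOPE: exponent bookkeeping inside the AKN/Cerf counting class
(crux dir `AKN-count-budget-c6.md`: floor ≈ 5 even with ideal inputs); it records where child 1's census starts
(aspect reduction `36 → 7/6`, versus `44 → 7/6` for the union form) and says nothing at `7/6`.

## References

* R. Cerf, *A lower bound on the two-arms exponent for critical percolation on the lattice*, Ann. Probab. 43 (2015),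
  Lemma 7.1, Cor. 7.2–7.3, Thm 1.1–1.2 (arXiv:1306.3105) [Cerf2015].
* M. Aizenman, H. Kesten, C. M. Newman, Comm. Math. Phys. 111 (1987) (two-arms bound) [AizenmanKestenNewmanCMP1987].
-/

noncomputable section

namespace Summit.CriticalPhenomena.PercolationContinuityZ3.Theorems

namespace NearLinearTwoClusterDecay.PairFrontier

open MeasureTheory Filter Topology
open Literature.Probability.LatticeModels Literature.Probability.Percolation
open Summit.CriticalPhenomena.PercolationContinuityZ3.Theorems.NearLinearTwoClusterDecay.Negative
open Summit.CriticalPhenomena.PercolationContinuityZ3.Theorems.NearLinearTwoClusterDecay.CritFrontier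

/-- **The union form dominates the pair form** (any parameter, any outer scale): if the union-form two-cluster
probability of `(Λ_n, Λ_{m n})` tends to `0`, then for every `ε > 0`, eventually, for ALL `x, x' ∈ Λ_n` the pair
event has probability `≤ ε` (a fixed pair is an instance of the existential pair). [folklore] -/
theorem pairDecay_of_twoClusterDecay (p : unitInterval) {m : ℕ → ℕ}
    (h : Tendsto (fun n : ℕ => (bondPercolation (zdGraph 3) p).real
      {ω | ∃ x ∈ box 3 n, ∃ x' ∈ box 3 n, ∃ y ∈ innerBoundary (zdGraph 3) (box 3 (m n)),
        ∃ y' ∈ innerBoundary (zdGraph 3) (box 3 (m n)),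
          ω ∈ openConnIn ↑(box 3 (m n)) x y ∧ ω ∈ openConnIn ↑(box 3 (m n)) x' y' ∧
            ω ∉ openConnIn ↑(box 3 (m n)) x x'}) atTop (𝓝 0)) :
    ∀ ε : ℝ, 0 < ε → ∀ᶠ n : ℕ in atTop, ∀ x ∈ box 3 n, ∀ x' ∈ box 3 n,
      (bondPercolation (zdGraph 3) p).real
        {ω | ∃ y ∈ innerBoundary (zdGraph 3) (box 3 (m n)), ∃ y' ∈ innerBoundary (zdGraph 3) (box 3 (m n)),
          ω ∈ openConnIn ↑(box 3 (m n)) x y ∧ ω ∈ openConnIn ↑(box 3 (m n)) x' y' ∧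
            ω ∉ openConnIn ↑(box 3 (m n)) x x'} ≤ ε := by
  intro ε hε
  filter_upwards [(tendsto_order.1 h).2 ε hε] with n hn x hx x' hx'
  refine le_trans (measureReal_mono ?_ (measure_ne_top _ _)) hn.le
  intro ω hω
  obtain ⟨y, hy, y', hy', h1, h2, h3⟩ := hω
  exact ⟨x, hx, x', hx', y, hy, y', hy', h1, h2, h3⟩

/-- **Subcritical pair decay at every exponent `A > 1`** (sharpness: the union form, indeed a single crossing, already
decays — `Negative.subcritical_crossing_decay`). [folklore] -/
theorem pairDecay_subcritical (p : unitInterval) (hp : (p : ℝ) < criticalProb (zdGraph 3) (0 : Site 3))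
    {A : ℝ} (hA : 1 < A) :
    ∀ ε : ℝ, 0 < ε → ∀ᶠ n : ℕ in atTop, ∀ x ∈ box 3 n, ∀ x' ∈ box 3 n,
      (bondPercolation (zdGraph 3) p).real
        {ω | ∃ y ∈ innerBoundary (zdGraph 3) (box 3 ⌈(n : ℝ) ^ A⌉₊),
          ∃ y' ∈ innerBoundary (zdGraph 3) (box 3 ⌈(n : ℝ) ^ A⌉₊),
            ω ∈ openConnIn ↑(box 3 ⌈(n : ℝ) ^ A⌉₊) x y ∧
            ω ∈ openConnIn ↑(box 3 ⌈(n : ℝ) ^ A⌉₊) x' y' ∧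
            ω ∉ openConnIn ↑(box 3 ⌈(n : ℝ) ^ A⌉₊) x x'} ≤ ε := by
  refine pairDecay_of_twoClusterDecay p (m := fun n => ⌈(n : ℝ) ^ A⌉₊) ?_
  have h := subcritical_crossing_decay p hp (m := fun n => ⌈(n : ℝ) ^ A⌉₊) (eventually_two_mul_le_ceil_rpow hA)
  exact squeeze_zero' (Eventually.of_forall fun n => measureReal_nonneg)
    (Eventually.of_forall fun n => measureReal_mono (twoClusterEvt_subset_crossingEvt _ _)) h

/-- **Pair-form two-cluster decay above aspect exponent `36` at every `p ∈ [p_c, 1)`** (Cerf 2015 Lemma 7.1 for a fixed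
pair, bond `ℤ³`, no hypothesis on `θ(p)`): W4 (pair bound `c n^{-12}`, `e = 12`) and the AKN exponent
`κ = (1/2 + 18/A)/2 < 1/2` in F1 (`κA = A/4 + 9 > 18 = 6 + 12`). [cite: Cerf2015, Lemma 7.1 and Cor 7.3] -/
theorem superCritPairDecay_of_gt_36 (p : unitInterval) (hpc : criticalProb (zdGraph 3) (0 : Site 3) ≤ (p : ℝ))
    (hp1 : (p : ℝ) < 1) {A : ℝ} (hA : 36 < A) :
    ∀ ε : ℝ, 0 < ε → ∀ᶠ n : ℕ in atTop, ∀ x ∈ box 3 n, ∀ x' ∈ box 3 n,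
      (bondPercolation (zdGraph 3) p).real
        {ω | ∃ y ∈ innerBoundary (zdGraph 3) (box 3 ⌈(n : ℝ) ^ A⌉₊),
          ∃ y' ∈ innerBoundary (zdGraph 3) (box 3 ⌈(n : ℝ) ^ A⌉₊),
            ω ∈ openConnIn ↑(box 3 ⌈(n : ℝ) ^ A⌉₊) x y ∧
            ω ∈ openConnIn ↑(box 3 ⌈(n : ℝ) ^ A⌉₊) x' y' ∧
            ω ∉ openConnIn ↑(box 3 ⌈(n : ℝ) ^ A⌉₊) x x'} ≤ ε := by
  have hp0 : 0 < (p : ℝ) := criticalProb_three_pos_lt_one.1.trans_le hpc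
  have hA0 : 0 < A := by linarith
  set κ : ℝ := (1 / 2 + 18 / A) / 2 with hκ
  have h18A : 18 / A < 1 / 2 := by rw [div_lt_iff₀ hA0]; linarith
  have hκlt : κ < 1 / 2 := by rw [hκ]; linarith
  have hκ0 : 0 < κ := by rw [hκ]; positivity
  have hκA : 6 + 12 < κ * A := by
    have : κ * A = A / 4 + 9 := by rw [hκ]; field_simp; ring
    rw [this]; linarith
  exact stub_pairAspectOfTwoArm p hp0 12 (by norm_num) (stub_superCritPairConnLower p hpc) κ hκ0
    (twoArm_of_lt_half_at p hp0 hp1 hκlt) A (by linarith) hκA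

/-- **Pair-form decay above aspect exponent `36` at EVERY `p < 1`**: below `p_c` by sharpness (`pairDecay_subcritical`),
from `p_c` on by `superCritPairDecay_of_gt_36`.  Union form: exponent `44` (`CritFrontier.twoClusterDecay_of_gt_44`).
[cite: Cerf2015, Lemma 7.1 and Cor 7.3] -/
theorem pairDecay_of_gt_36 (p : unitInterval) (hp1 : (p : ℝ) < 1) {A : ℝ} (hA : 36 < A) :
    ∀ ε : ℝ, 0 < ε → ∀ᶠ n : ℕ in atTop, ∀ x ∈ box 3 n, ∀ x' ∈ box 3 n,
      (bondPercolation (zdGraph 3) p).real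
        {ω | ∃ y ∈ innerBoundary (zdGraph 3) (box 3 ⌈(n : ℝ) ^ A⌉₊),
          ∃ y' ∈ innerBoundary (zdGraph 3) (box 3 ⌈(n : ℝ) ^ A⌉₊),
            ω ∈ openConnIn ↑(box 3 ⌈(n : ℝ) ^ A⌉₊) x y ∧
            ω ∈ openConnIn ↑(box 3 ⌈(n : ℝ) ^ A⌉₊) x' y' ∧
            ω ∉ openConnIn ↑(box 3 ⌈(n : ℝ) ^ A⌉₊) x x'} ≤ ε := by
  rcases lt_or_ge (p : ℝ) (criticalProb (zdGraph 3) (0 : Site 3)) with hlt | hge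
  · exact pairDecay_subcritical p hlt (by linarith)
  · exact superCritPairDecay_of_gt_36 p hge hp1 hA

/-- **At `p_c`: pair-form decay at every exponent `A > 36`, unconditionally** (the instance `p = p_c` of
`pairDecay_of_gt_36`). [cite: Cerf2015, Lemma 7.1] -/
theorem critPairDecay_of_gt_36 {A : ℝ} (hA : 36 < A) :
    ∀ ε : ℝ, 0 < ε → ∀ᶠ n : ℕ in atTop, ∀ x ∈ box 3 n, ∀ x' ∈ box 3 n,
      (bondPercolation (zdGraph 3) (criticalProbI 3)).real
        {ω | ∃ y ∈ innerBoundary (zdGraph 3) (box 3 ⌈(n : ℝ) ^ A⌉₊),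
          ∃ y' ∈ innerBoundary (zdGraph 3) (box 3 ⌈(n : ℝ) ^ A⌉₊),
            ω ∈ openConnIn ↑(box 3 ⌈(n : ℝ) ^ A⌉₊) x y ∧
            ω ∈ openConnIn ↑(box 3 ⌈(n : ℝ) ^ A⌉₊) x' y' ∧
            ω ∉ openConnIn ↑(box 3 ⌈(n : ℝ) ^ A⌉₊) x x'} ≤ ε :=
  pairDecay_of_gt_36 (criticalProbI 3) (by rw [coe_criticalProbI]; exact criticalProb_three_pos_lt_one.2) hA

/-- **At `p_c`: pair-form decay at every exponent `A ≥ 36`** — with bond Cerf Thm 1.1 at `p_c` (W2: some two-arms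
exponent `κ₀ > 1/2`) the condition `κ₀ A > 18` holds at `A = 36` itself (`κ₀ A ≥ 36 κ₀ > 18`); no monotonicity in
the exponent is used. [cite: Cerf2015, Thm 1.1 and Lemma 7.1] -/
theorem critPairDecay_of_ge_36 :
    ∀ A : ℝ, 36 ≤ A → ∀ ε : ℝ, 0 < ε → ∀ᶠ n : ℕ in atTop, ∀ x ∈ box 3 n, ∀ x' ∈ box 3 n,
      (bondPercolation (zdGraph 3) (criticalProbI 3)).real
        {ω | ∃ y ∈ innerBoundary (zdGraph 3) (box 3 ⌈(n : ℝ) ^ A⌉₊),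
          ∃ y' ∈ innerBoundary (zdGraph 3) (box 3 ⌈(n : ℝ) ^ A⌉₊),
            ω ∈ openConnIn ↑(box 3 ⌈(n : ℝ) ^ A⌉₊) x y ∧
            ω ∈ openConnIn ↑(box 3 ⌈(n : ℝ) ^ A⌉₊) x' y' ∧
            ω ∉ openConnIn ↑(box 3 ⌈(n : ℝ) ^ A⌉₊) x x'} ≤ ε := by
  intro A hA
  obtain ⟨κ₀, hκ₀, hT⟩ := stub_critTwoArmImproved stub_critPairConnLower
  have hκ0 : 0 < κ₀ := by linarith
  have hp0 : 0 < ((criticalProbI 3 : unitInterval) : ℝ) := by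
    rw [coe_criticalProbI]; exact criticalProb_three_pos_lt_one.1
  have hκA : 6 + 12 < κ₀ * A := by nlinarith
  exact stub_pairAspectOfTwoArm (criticalProbI 3) hp0 12 (by norm_num) stub_critPairConnLower κ₀ hκ0 hT A
    (by linarith) hκA

/-- **Status of the PAIR-form family at `p_c` (for the planner filing child 1)**: pair-form decay holds at every exponent
`≥ 36` (this file) while the union form is certified only from `44` on (`CritFrontier.critAtExponent_of_ge_44`) and
fails at every exponent `≤ 1` (`Negative.not_atExponent_of_le_one`); child 1 `PairTwoArmsDecay` is the pair instance
`A = 7/6`, so its open content is the aspect reduction `36 → 7/6` (in the jump world; in the `θ(p_c) = 0` world it is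
automatic, `Theorems.stub_pairDecayNullWorld`). [folklore] -/
theorem pairDecay_status :
    (∀ A : ℝ, 36 ≤ A → ∀ ε : ℝ, 0 < ε → ∀ᶠ n : ℕ in atTop, ∀ x ∈ box 3 n, ∀ x' ∈ box 3 n,
      (bondPercolation (zdGraph 3) (criticalProbI 3)).real
        {ω | ∃ y ∈ innerBoundary (zdGraph 3) (box 3 ⌈(n : ℝ) ^ A⌉₊),
          ∃ y' ∈ innerBoundary (zdGraph 3) (box 3 ⌈(n : ℝ) ^ A⌉₊),
            ω ∈ openConnIn ↑(box 3 ⌈(n : ℝ) ^ A⌉₊) x y ∧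
            ω ∈ openConnIn ↑(box 3 ⌈(n : ℝ) ^ A⌉₊) x' y' ∧
            ω ∉ openConnIn ↑(box 3 ⌈(n : ℝ) ^ A⌉₊) x x'} ≤ ε) ∧
    (∀ A : ℝ, 44 ≤ A → AtExponent A) ∧
    (∀ A : ℝ, A ≤ 1 → ¬ AtExponent A) :=
  ⟨critPairDecay_of_ge_36, fun _ hA => critAtExponent_of_ge_44 hA, fun _ hA => not_atExponent_of_le_one hA⟩

end NearLinearTwoClusterDecay.PairFrontier

end Summit.CriticalPhenomena.PercolationContinuityZ3.Theorems
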